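import Summits.BirchSwinnertonDyer.BirchSwinnertonDyer.Theorems.BiquadraticEisensteinDescentHeegnerTwistCouplingInSupplySylvesterCornerClosed
import Literature.NumberTheory.EllipticCurves.Rank1Residual.Predicates
import HarnessLib

set_option linter.dupNamespace false -- `Summit.BirchSwinnertonDyer.BirchSwinnertonDyer.Theorems.…` (summit = sub, D-0017)
set_option autoImplicit false

/-!
# Crux `HeegnerTwistCouplingInSupply` (stmt-BirchSwinnertonDyer-21381) RESTRICTED TO THE SYLVESTER FAMILY `{W_n : n prime, n ≡ 8 (mod 9), n < 10⁵}`
# — the crux body VERBATIM, with `W := W_n = ⟨0, 0, n, 0, 0⟩`, modulo the unit-form `3`-descent hypothesis and Burungale–Tian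

Route `BiquadraticEisensteinDescent` (cell `pub/bsd-wall`; width seat `bsd-wall-cm-bed-w4` g26; theorems only, `--supports` 21381, helper).
Bookkeeping sequel of `…SylvesterCornerClosed` (the corner for every prime `p ≡ 8 (mod 9)` below `10⁵`), in the shape of bed-w2 g13's
`…RoundingPinCruxOnFamily` for `E_n`. The route decl `Summit.…Theses.BiquadraticEisensteinDescent.HeegnerTwistCouplingInSupply` reads: for
every `W` (elliptic, globally minimal, `N_W ≠ 0`) and every prime `p` with `W.HasCM`, `r_an(W) = 1`, `5 ≤ p`, `CMInert W p`, `¬ Good W p`, IF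
for every bound `B` there is a Heegner field of `N_W` with `B < |d|`, `4 < |d|`, `p ∤ h`, THEN there is one with `L(W^{(d)}, 1) ≠ 0` as well.
This file proves that body with ONE extra hypothesis, `W = W_n` for a prime `n ≡ 8 (mod 9)`, `n < 10⁵` — and uses only `¬ Good` and
`5 ≤ p` among the others: the bad primes of `W_n` are `3` and `n` (`hasGoodReductionAtPrime_W`), so `p = n`, and the conclusion is
`cruxOnSylvesterCorner_closed_lt5` at `n`.

* `eq_of_not_good_sylvester` — `¬ Good W_n p`, `5 ≤ p`, `n` prime ⇒ `p = n`;
* ★★ `heegnerTwistCouplingInSupply_sylvester` — the crux body for `W := W_n`, `n` prime `≡ 8 (mod 9)`, `n < 10⁵`, every `p`;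
* ★★ `heegnerTwistCouplingInSupply_of_eq_sylvester` — the crux body for every `W` with `∃ n, n.Prime ∧ n % 9 = 8 ∧ n < 10⁵ ∧ W = W_n`.

Both modulo `hDescU` (card `splitting-bias` L1: the `3`-isogeny descent on `y² = x³ + 16p²D³` in UNIT form — NOT formalised) and
Burungale–Tian's corank-zero converse ONLY. HONEST FRAMING: the family `{W_n}` has measure zero in «all CM `W` of analytic rank one»;
the crux (residual C⁺ on the tail) is NOT closed; BSD is not proved by any of this. THEOREMS ONLY; the Theses module is not imported (the
body is restated with `W` instantiated, not the closed decl). [cite: CohenPazuki2009, §2] [cite: BurungaleTian2026, Thm. 1.1]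
[cite: SilvermanAEC2009, VII.5 Prop. 5.1(a)]
-/

noncomputable section

open scoped Classical NumberField

namespace Summit.BirchSwinnertonDyer.BirchSwinnertonDyer.Theorems.SylvesterCorner

open _root_.WeierstrassCurve Literature.NumberTheory.EllipticCurves Literature.NumberTheory.EllipticCurves.Rank1Residual

/-- **The only bad prime `≥ 5` of `W_n` is `n`**: for a prime `n` and a prime `p ≥ 5` of bad reduction of `W_n : y² + n·y = x³`, `p = n`
(`W_n` has good reduction at every prime not dividing `3n`). [cite: SilvermanAEC2009, VII.5 Prop. 5.1(a)] -/
theorem eq_of_not_good_sylvester {n p : ℕ} [Fact p.Prime] (hn : n.Prime) (h5 : 5 ≤ p)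
    (hbad : ¬ Good (⟨0, 0, (n : ℚ), 0, 0⟩ : WeierstrassCurve ℚ) p) : p = n := by
  have hp : p.Prime := Fact.out
  by_contra hne
  refine hbad (hasGoodReductionAtPrime_W fun hdvd => ?_)
  rcases (Nat.Prime.dvd_mul hp).mp hdvd with h3 | h
  · have := (Nat.prime_dvd_prime_iff_eq hp Nat.prime_three).mp h3
    omega
  · exact hne ((Nat.prime_dvd_prime_iff_eq hp hn).mp h)

/-- ★★ **THE CRUX BODY ON `W := W_n`, `n` prime `≡ 8 (mod 9)`, `n < 10⁵`.** For every prime `p` and all the crux's hypotheses on `(W_n, p)`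
(CM, analytic rank one, `5 ≤ p`, `p` CM-inert and bad, Heegner fields of `N(W_n)` with `p ∤ h` beyond every bound): a Heegner field `K′` of
`N(W_n)` with `4 < |d_{K′}|`, `L(W_n^{(d_{K′})}, 1) ≠ 0` and `p ∤ h(K′)` — modulo `hDescU` and Burungale–Tian ONLY. Only `¬ Good` and `5 ≤ p`
are used (`p = n`); the rest is `cruxOnSylvesterCorner_of_descUnit_BT_lt5`. [cite: CohenPazuki2009, §2] [cite: BurungaleTian2026, Thm. 1.1] -/
theorem heegnerTwistCouplingInSupply_sylvester
    (hDescU : ∀ (p : ℕ) (K : Type) [Field K] [NumberField K], p.Prime → p % 9 = 8 →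
      IsImaginaryQuadratic K → 4 < (NumberField.discr K).natAbs →
      jacobiSym (NumberField.discr K) 3 = 1 → jacobiSym (NumberField.discr K) p = 1 →
      ¬ 3 ∣ NumberField.classNumber K →
      (∀ (L : Type) [Field L] [NumberField L], Module.finrank ℚ L = 2 →
        NumberField.discr L = -3 * NumberField.discr K →
        ∃ u : (𝓞 L)ˣ, ∀ x : 𝓞 L, (u : 𝓞 L) - x ^ 3 ∉ Ideal.span {(p : 𝓞 L)}) →
      ((⟨0, 0, (p : ℚ), 0, 0⟩ : WeierstrassCurve ℚ).quadraticTwist (NumberField.discr K : ℚ)).mordellWeilRank = 0 ∧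
      ∀ c ∈ ((⟨0, 0, (p : ℚ), 0, 0⟩ : WeierstrassCurve ℚ).quadraticTwist (NumberField.discr K : ℚ)).sha,
        3 • c = 0 → c = 0)
    (hBT : burungaleTian_analyticRank_eq_zero_of_selmerCorank_eq_zero_of_hasCM) {n : ℕ} (hn : n.Prime) (hn9 : n % 9 = 8)
    (hlt : n < 100000) :
    ∀ (p : ℕ) [Fact p.Prime] [(⟨0, 0, (n : ℚ), 0, 0⟩ : WeierstrassCurve ℚ).IsElliptic]
      [(⟨0, 0, (n : ℚ), 0, 0⟩ : WeierstrassCurve ℚ).IsGloballyMinimal]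
      [NeZero ((⟨0, 0, (n : ℚ), 0, 0⟩ : WeierstrassCurve ℚ).conductorNorm ℤ)],
      (⟨0, 0, (n : ℚ), 0, 0⟩ : WeierstrassCurve ℚ).HasCM → (⟨0, 0, (n : ℚ), 0, 0⟩ : WeierstrassCurve ℚ).analyticRank = 1 → 5 ≤ p →
      CMInert (⟨0, 0, (n : ℚ), 0, 0⟩ : WeierstrassCurve ℚ) p → ¬ Good (⟨0, 0, (n : ℚ), 0, 0⟩ : WeierstrassCurve ℚ) p →
      (∀ B : ℕ, ∃ (K : Type) (_ : Field K) (_ : NumberField K), IsImaginaryQuadratic K ∧ B < (NumberField.discr K).natAbs ∧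
        4 < (NumberField.discr K).natAbs ∧
        SatisfiesHeegnerHypothesis ((⟨0, 0, (n : ℚ), 0, 0⟩ : WeierstrassCurve ℚ).conductorNorm ℤ) K ∧
        ¬ p ∣ NumberField.classNumber K) →
      ∃ (K : Type) (_ : Field K) (_ : NumberField K),
        IsImaginaryQuadratic K ∧ 4 < (NumberField.discr K).natAbs ∧
        SatisfiesHeegnerHypothesis ((⟨0, 0, (n : ℚ), 0, 0⟩ : WeierstrassCurve ℚ).conductorNorm ℤ) K ∧
        ((⟨0, 0, (n : ℚ), 0, 0⟩ : WeierstrassCurve ℚ).quadraticTwist (NumberField.discr K : ℚ)).entireLFunction 1 ≠ 0 ∧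
        ¬ p ∣ NumberField.classNumber K := by
  intro p _ _ _ _ _ _ h5 _ hbad _
  obtain rfl := eq_of_not_good_sylvester hn h5 hbad
  haveI : Fact p.Prime := ⟨hn⟩
  obtain ⟨K, iF, iN, hK, h4, hH, hL, -, hndvd⟩ := cruxOnSylvesterCorner_of_descUnit_BT_lt5 hDescU hBT p hn9 hlt
  exact ⟨K, iF, iN, hK, h4, hH, hL, hndvd⟩

/-- ★★ **THE CRUX BODY FOR EVERY `W` IN THE FAMILY `{W_n : n prime, n ≡ 8 (mod 9), n < 10⁵}`** — the universally quantified body of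
`HeegnerTwistCouplingInSupply` with the single extra hypothesis `∃ n, n.Prime ∧ n % 9 = 8 ∧ n < 10⁵ ∧ W = W_n`, modulo `hDescU` and
Burungale–Tian ONLY. [cite: CohenPazuki2009, §2] [cite: BurungaleTian2026, Thm. 1.1] -/
theorem heegnerTwistCouplingInSupply_of_eq_sylvester
    (hDescU : ∀ (p : ℕ) (K : Type) [Field K] [NumberField K], p.Prime → p % 9 = 8 →
      IsImaginaryQuadratic K → 4 < (NumberField.discr K).natAbs →
      jacobiSym (NumberField.discr K) 3 = 1 → jacobiSym (NumberField.discr K) p = 1 →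
      ¬ 3 ∣ NumberField.classNumber K →
      (∀ (L : Type) [Field L] [NumberField L], Module.finrank ℚ L = 2 →
        NumberField.discr L = -3 * NumberField.discr K →
        ∃ u : (𝓞 L)ˣ, ∀ x : 𝓞 L, (u : 𝓞 L) - x ^ 3 ∉ Ideal.span {(p : 𝓞 L)}) →
      ((⟨0, 0, (p : ℚ), 0, 0⟩ : WeierstrassCurve ℚ).quadraticTwist (NumberField.discr K : ℚ)).mordellWeilRank = 0 ∧
      ∀ c ∈ ((⟨0, 0, (p : ℚ), 0, 0⟩ : WeierstrassCurve ℚ).quadraticTwist (NumberField.discr K : ℚ)).sha,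
        3 • c = 0 → c = 0)
    (hBT : burungaleTian_analyticRank_eq_zero_of_selmerCorank_eq_zero_of_hasCM) :
    ∀ (W : WeierstrassCurve ℚ) [W.IsElliptic] [W.IsGloballyMinimal] (p : ℕ) [Fact p.Prime] [NeZero (W.conductorNorm ℤ)],
      (∃ n : ℕ, n.Prime ∧ n % 9 = 8 ∧ n < 100000 ∧ W = ⟨0, 0, (n : ℚ), 0, 0⟩) →
      W.HasCM → W.analyticRank = 1 → 5 ≤ p → CMInert W p → ¬ Good W p →
      (∀ B : ℕ, ∃ (K : Type) (_ : Field K) (_ : NumberField K), IsImaginaryQuadratic K ∧ B < (NumberField.discr K).natAbs ∧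
        4 < (NumberField.discr K).natAbs ∧ SatisfiesHeegnerHypothesis (W.conductorNorm ℤ) K ∧ ¬ p ∣ NumberField.classNumber K) →
      ∃ (K : Type) (_ : Field K) (_ : NumberField K),
        IsImaginaryQuadratic K ∧ 4 < (NumberField.discr K).natAbs ∧
        SatisfiesHeegnerHypothesis (W.conductorNorm ℤ) K ∧
        (W.quadraticTwist (NumberField.discr K : ℚ)).entireLFunction 1 ≠ 0 ∧ ¬ p ∣ NumberField.classNumber K := by
  intro W _ _ p _ _ hW hCM hr h5 hinert hbad hsupply
  obtain ⟨n, hn, hn9, hlt, rfl⟩ := hW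
  exact heegnerTwistCouplingInSupply_sylvester hDescU hBT hn hn9 hlt p hCM hr h5 hinert hbad hsupply

end Summit.BirchSwinnertonDyer.BirchSwinnertonDyer.Theorems.SylvesterCorner
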